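import Mathlib
import HarnessLib
import Literature.Probability.Distributions.PseudoMarginalGaussianNoise
import Summits.Ventures.LatticeQCDFlow.Exactness.NCMCGeneralSpaceWorkLaw

/-!
# GaussianWorkSampleSize — WHERE the exponential work averages live in the Gaussian work model:
# half of `⟨e^{−kW_d}⟩` comes from `{W_d ≤ ⟨W_d⟩ − k·Var W}`, a region of probability
# `Φ(−k√Var W) ≤ e^{−k²Var W/2}`; so the Jarzynski mean (`k = 1`) needs `N ≫ 1/√ESS` evolutions and
# the Kish ESS denominator (`k = 2`) needs `N ≫ 1/ESS²` before the sample can see them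

HONEST FRAMING: exact (Metropolis-corrected) sampling algorithms for lattice gauge theory;
figures of merit are autocorrelation/cost numbers at stated couplings and volumes; no
continuum-physics claim.

Venture `LatticeQCDFlow` (cell pub-lqcd), topic `Scaling`; FANOUT row 19 (`su2-snf`, GEN-7).
OUR WORK (elementary Gaussian calculus over Mathlib's `gaussianReal` API); nothing is cited as a
fact.  The rare-event reading of exponential work averages (C. Jarzynski, Phys. Rev. E 73 (2006)
046105: the dominant realisations of `⟨e^{−W}⟩` are the typical realisations of the REVERSE
process, and their number controls convergence) is NAMED ONLY; the general sample-size theorem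
"`n ≈ exp D(ν‖μ)`" is the Literature's `ImportanceSampling/ChatterjeeDiaconis` (Chatterjee–Diaconis
2018, Thm 1.1, proved there) and the log-normal weight moments are the Literature's
`ImportanceSampling/LogNormalWeights` (Crow–Shimizu (4.1)–(4.10)) — both are the general facts of
which the SET-RESTRICTED Gaussian identities below are the model-specific sharpening (where, not
only how large).  Vocabulary: the Gaussian work model of `Scaling/GaussianWorkDictionary` — the
dissipated work `W_d = W − ΔF` has law `gaussianReal (s/2) s` (variance `s`, mean `s/2` forced by
Jarzynski) —, `Φ(t) = (gaussianReal 0 1 (Iic t)).toReal`, and the measure-level tilt identity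
`GeneralNCMC.gaussianReal_withDensity_exp_linear` of `Exactness/NCMCGeneralSpaceWorkLaw`
(row 13), which is USED, not restated.  Dictionary to Chatterjee–Diaconis: the `k`-tilted work law
`N(s/2 − ks, s)` is the target whose importance-sampling estimate from the work law is the `k`-th
exponential moment, and `D(N(s/2 − ks, s) ‖ N(s/2, s)) = k²s/2` is exactly the exponent of the
thresholds below (`e^{s/2}` for the Jarzynski mean, `e^{2s}` for the Kish denominator).

WHY (row 19's boarding rule for NE-MCMC arms, CARD-su2-snf §3 / HANDOFF P8).  The LEADERBOARD's
ESS column is the SAMPLE Kish fraction `(Σ wᵢ)²/(N Σ wᵢ²)` of `N` forward evolutions,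
`wᵢ = e^{−W_d,i}`; its population value in the model is `e^{−s}` (`gaussianWork_kishESS`).  The
denominator estimates `⟨e^{−2W_d}⟩ = e^{s}`, an average carried by evolutions far in the LOWER
tail of the work distribution.  This file quantifies "far": for every real `k`,

* `setIntegral_exp_mul_gaussianReal` — the set-restricted tilt identity
  `∫_A e^{tx} N(m, v)(dx) = e^{mt + vt²/2} · N(m + vt, v)(A)` (every `v`, every measurable `A`);
* `gaussianWork_expMoment` — `⟨e^{−kW_d}⟩ = e^{s·k(k−1)/2}` (`k = 1`: Jarzynski; `k = 2`: `e^{s}`);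
* **`gaussianWork_expMoment_restrict`** — `∫_A e^{−kx} N(s/2, s)(dx) = e^{s·k(k−1)/2}·N(s/2 − ks, s)(A)`:
  the `k`-th exponential moment is distributed like the `k`-TILTED work law, a Gaussian of the
  same variance centred `k·s = k·Var W` BELOW the mean work;
* **`gaussianWork_expMoment_lowerHalf`** — exactly HALF of `⟨e^{−kW_d}⟩` is carried by the region
  `{W_d ≤ s/2 − ks}`;
* **`gaussianWork_dominantRegion_eq_cdf`** — that region has probability `Φ(−k√s)` under the work
  law, and **`gaussianWork_dominantRegion_le`** — `Φ(−k√s) ≤ e^{−k²s/2}` (Chernoff);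
* `gaussianWork_expMoment_relVar` — `⟨e^{−2kW_d}⟩/⟨e^{−kW_d}⟩² = e^{k²s}`: the relative variance of
  the weight power `w^k` is `e^{k²s} − 1`, so a CLT-grade estimate of `⟨w^k⟩` needs
  `N ≫ e^{k²s}` evolutions;
* the two readings of record: `k = 1` (the Jarzynski mean, i.e. `ΔF̂`):
  `gaussianWork_jarzynski_lowerHalf`, `gaussianWork_jarzynski_dominantRegion_le`
  (`P ≤ e^{−s/2} = √ESS`); `k = 2` (the Kish denominator): `gaussianWork_kish_lowerHalf`,
  **`gaussianWork_kish_dominantRegion_le`** (`P ≤ e^{−2s} = ESS²`), and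
  **`gaussianWork_kish_expectedCount_le`**: among `N` evolutions the expected number landing in
  the region that carries half of `⟨e^{−2W_d}⟩` is `≤ N·e^{−2s} = N·ESS²`.

READING (value-free).  A sample Kish ESS computed from `N` evolutions can only be an estimate of
the population value `e^{−s}` if `N·Φ(−2√s)` — at most `N·ESS²` — is well above `1`; below that the
sample has, in expectation, no evolution in the half-mass region of the denominator and the printed
fraction is a small-sample artefact in either direction (most samples miss the region and
over-state ESS; one hit dominates `Σ wᵢ²` and collapses it).  The Jarzynski mean is easier by a
square root (`N·Φ(−√s) ≤ N·√ESS`), a CLT error bar for it needs `N ≫ e^{s} = 1/ESS`, and one for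
the Kish denominator `N ≫ e^{4s} = 1/ESS⁴`.  Orientation only (not typed): the row's F1 arm
`L_d 2 ns28` has `Var W ≈ 2.6`, `N = 605`, `N·Φ(−2√2.6) ≈ 0.4` — labelled 'unranked (low-ESS)'.

NOT CLAIMED: anything about non-Gaussian work laws (the finite path spaces of `Exactness/` are
never Gaussian); the distribution of the sample Kish fraction itself (row 4's
`Scoring/KishESSCeilingFree` / `KishESSHeavyTail` certify it from block medians under moment
hypotheses; in the model their fourth-moment ratio `M₄/M₂²` is the `e^{4s}` above).
-/

namespace Summit.Ventures.LatticeQCDFlow.Theory2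

open MeasureTheory ProbabilityTheory Set
open scoped NNReal ENNReal
open Summit.Ventures.LatticeQCDFlow.Exactness.GeneralNCMC (gaussianReal_withDensity_exp_linear)
open Literature.Probability.Distributions.PseudoMarginalNoise (gaussianReal_Iic_eq_std)

/-! ## The set-restricted exponential tilt of a Gaussian -/

/-- **Set-restricted tilt identity**: `∫_A e^{tx} N(m, v)(dx) = e^{mt + vt²/2} · N(m + vt, v)(A)`
for every real `t`, every variance `v` (also `v = 0`) and every measurable `A` — the measure-level
identity `N(m, v)·e^{tx − (mt + vt²/2)} = N(m + vt, v)` of `Exactness/NCMCGeneralSpaceWorkLaw`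
evaluated on `A`. [ours] -/
theorem setIntegral_exp_mul_gaussianReal (m t : ℝ) (v : ℝ≥0) {A : Set ℝ} (hA : MeasurableSet A) :
    ∫ x in A, Real.exp (t * x) ∂(gaussianReal m v)
      = Real.exp (m * t + (v : ℝ) * t ^ 2 / 2) * (gaussianReal (m + (v : ℝ) * t) v A).toReal := by
  have htilt := gaussianReal_withDensity_exp_linear m v t
  -- the tilted measure of `A` as a set integral of the (non-negative) tilt density
  have hdens : ∫ x in A, Real.exp (t * x - (m * t + (v : ℝ) * t ^ 2 / 2)) ∂(gaussianReal m v)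
      = (gaussianReal (m + (v : ℝ) * t) v A).toReal := by
    rw [integral_eq_lintegral_of_nonneg_ae (ae_of_all _ fun x => (Real.exp_pos _).le)
        (Measurable.aestronglyMeasurable (by fun_prop)), ← htilt, withDensity_apply _ hA]
  have hsplit : ∀ x, Real.exp (t * x)
      = Real.exp (m * t + (v : ℝ) * t ^ 2 / 2)
          * Real.exp (t * x - (m * t + (v : ℝ) * t ^ 2 / 2)) := by
    intro x
    rw [← Real.exp_add]
    congr 1
    ring
  simp_rw [hsplit]
  rw [integral_const_mul, hdens]

/-! ## The Gaussian work model: where `⟨e^{−kW_d}⟩` lives -/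

section Work

variable (s : ℝ≥0)

/-- **`⟨e^{−kW_d}⟩ = e^{s·k(k−1)/2}`** for `W_d ∼ N(s/2, s)` and every real `k` (`k = 1`:
Jarzynski's `1`; `k = 2`: the Kish denominator `e^{s}`; from Mathlib's Gaussian mgf). [ours] -/
theorem gaussianWork_expMoment (k : ℝ) :
    ∫ x, Real.exp (-(k * x)) ∂(gaussianReal ((s : ℝ) / 2) s)
      = Real.exp ((s : ℝ) * (k * (k - 1)) / 2) := by
  have h := congrFun (mgf_id_gaussianReal (μ := (s : ℝ) / 2) (v := s)) (-k)
  simp only [mgf, id_eq] at h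
  have e : ∀ x : ℝ, -(k * x) = -k * x := fun x => by ring
  simp_rw [e]
  rw [h]
  congr 1
  ring

/-- **WHERE THE `k`-TH EXPONENTIAL MOMENT LIVES**: for every measurable `A`,
`∫_A e^{−kx} N(s/2, s)(dx) = e^{s·k(k−1)/2} · N(s/2 − ks, s)(A)` — restricted to any region, the
moment is the full moment times the mass of the `k`-tilted work law, the Gaussian of the same
variance centred `ks` below the mean work. [ours] -/
theorem gaussianWork_expMoment_restrict (k : ℝ) {A : Set ℝ} (hA : MeasurableSet A) :
    ∫ x in A, Real.exp (-(k * x)) ∂(gaussianReal ((s : ℝ) / 2) s)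
      = Real.exp ((s : ℝ) * (k * (k - 1)) / 2)
          * (gaussianReal ((s : ℝ) / 2 - k * s) s A).toReal := by
  have h := setIntegral_exp_mul_gaussianReal ((s : ℝ) / 2) (-k) s hA
  have e : ∀ x : ℝ, -(k * x) = -k * x := fun x => by ring
  simp_rw [e]
  rw [h, show (s : ℝ) / 2 * -k + (s : ℝ) * (-k) ^ 2 / 2 = (s : ℝ) * (k * (k - 1)) / 2 by ring,
    show (s : ℝ) / 2 + (s : ℝ) * -k = (s : ℝ) / 2 - k * s by ring]

/-- Half of a non-degenerate Gaussian's mass lies below its mean: `N(m, v)(−∞, m] = 1/2`. [folklore] -/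
theorem toReal_gaussianReal_Iic_self (m : ℝ) {v : ℝ≥0} (hv : v ≠ 0) :
    (gaussianReal m v (Iic m)).toReal = 1 / 2 := by
  rw [gaussianReal_Iic_eq_std m hv m, sub_self, zero_div]
  have hsym : gaussianReal 0 1 (Iic 0) = gaussianReal 0 1 (Ici 0) := by
    have h := gaussianReal_map_neg (μ := (0 : ℝ)) (v := (1 : ℝ≥0))
    rw [neg_zero] at h
    conv_lhs => rw [← h]
    rw [Measure.map_apply measurable_neg measurableSet_Iic]
    congr 1
    ext x
    simp
  have hone : gaussianReal 0 1 (Iic 0) + gaussianReal 0 1 (Ioi 0) = 1 := by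
    rw [← measure_union (Iic_disjoint_Ioi le_rfl) measurableSet_Ioi, Iic_union_Ioi, measure_univ]
  haveI := nullSingletonClass_gaussianReal (μ := (0 : ℝ)) (one_ne_zero : (1 : ℝ≥0) ≠ 0)
  have hIoi : gaussianReal 0 1 (Ioi 0) = gaussianReal 0 1 (Ici 0) := measure_congr Ioi_ae_eq_Ici
  rw [hIoi, ← hsym, ← two_mul] at hone
  have h2 : (gaussianReal 0 1 (Iic 0)).toReal * 2 = 1 := by
    have := congrArg ENNReal.toReal hone
    rwa [ENNReal.toReal_mul, mul_comm] at this
  linarith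

variable {s}

/-- **HALF OF `⟨e^{−kW_d}⟩` IS CARRIED BY `{W_d ≤ s/2 − ks}`** (`s ≠ 0`): the integral of
`e^{−kx}` over the work values at least `k·Var W` below the mean work is exactly half of the full
moment `e^{s·k(k−1)/2}`. [ours] -/
theorem gaussianWork_expMoment_lowerHalf (hs : s ≠ 0) (k : ℝ) :
    ∫ x in Iic ((s : ℝ) / 2 - k * s), Real.exp (-(k * x)) ∂(gaussianReal ((s : ℝ) / 2) s)
      = Real.exp ((s : ℝ) * (k * (k - 1)) / 2) / 2 := by
  rw [gaussianWork_expMoment_restrict s k measurableSet_Iic, toReal_gaussianReal_Iic_self _ hs]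
  ring

/-- **THE DOMINANT REGION HAS PROBABILITY `Φ(−k√s)`** under the work law (`s ≠ 0`):
`N(s/2, s)(−∞, s/2 − ks] = N(0, 1)(−∞, −k√s]`. [ours] -/
theorem gaussianWork_dominantRegion_eq_cdf (hs : s ≠ 0) (k : ℝ) :
    (gaussianReal ((s : ℝ) / 2) s (Iic ((s : ℝ) / 2 - k * s))).toReal
      = (gaussianReal 0 1 (Iic (-(k * Real.sqrt (s : ℝ))))).toReal := by
  have hs0 : (0 : ℝ) < s := by exact_mod_cast pos_iff_ne_zero.mpr hs
  have hsq : Real.sqrt (s : ℝ) ≠ 0 := (Real.sqrt_pos.mpr hs0).ne'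
  rw [gaussianReal_Iic_eq_std _ hs]
  congr 3
  rw [show (s : ℝ) / 2 - k * s - (s : ℝ) / 2 = -(k * s) by ring]
  have : (s : ℝ) = Real.sqrt (s : ℝ) * Real.sqrt (s : ℝ) := (Real.mul_self_sqrt hs0.le).symm
  rw [neg_div, mul_div_assoc]
  congr 2
  rw [div_eq_iff hsq]
  nth_rewrite 1 [this]
  ring

/-- **Chernoff bound for the dominant region**: `Φ(−k√s) ≤ e^{−k²s/2}` (for `k ≥ 0`; Markov's
inequality on `e^{−k√s·Z}`, `Z ∼ N(0, 1)`, whose mgf is Mathlib's). [ours] -/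
theorem cdf_neg_mul_sqrt_le_exp {k : ℝ} (hk : 0 ≤ k) (s : ℝ≥0) :
    (gaussianReal 0 1 (Iic (-(k * Real.sqrt (s : ℝ))))).toReal
      ≤ Real.exp (-(k ^ 2 * (s : ℝ)) / 2) := by
  set a : ℝ := k * Real.sqrt (s : ℝ) with ha
  have ha0 : 0 ≤ a := mul_nonneg hk (Real.sqrt_nonneg _)
  have hint : Integrable (fun ω : ℝ => Real.exp (-a * id ω)) (gaussianReal 0 1) := by
    simpa using integrable_exp_mul_gaussianReal (μ := (0 : ℝ)) (v := (1 : ℝ≥0)) (-a)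
  have h := measure_le_le_exp_mul_mgf (X := id) (μ := gaussianReal 0 1) (-a)
    (neg_nonpos.mpr ha0) hint
  have hmgf : mgf id (gaussianReal 0 1) (-a) = Real.exp (a ^ 2 / 2) := by
    rw [congrFun (mgf_id_gaussianReal (μ := (0 : ℝ)) (v := (1 : ℝ≥0))) (-a)]
    congr 1
    push_cast
    ring
  have hset : {ω : ℝ | id ω ≤ -a} = Iic (-a) := by ext x; simp
  rw [hmgf, hset, Measure.real] at h
  refine h.trans (le_of_eq ?_)
  rw [← Real.exp_add]
  congr 1
  have haa : a ^ 2 = k ^ 2 * (s : ℝ) := by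
    rw [ha, mul_pow, Real.sq_sqrt (NNReal.coe_nonneg s)]
  linear_combination (-1 / 2 : ℝ) * haa

/-- **`P(dominant region) ≤ e^{−k²s/2}`** for the work law: for `k ≥ 0` and `s ≠ 0`,
`N(s/2, s)(−∞, s/2 − ks] ≤ e^{−k²s/2}`. [ours] -/
theorem gaussianWork_dominantRegion_le (hs : s ≠ 0) {k : ℝ} (hk : 0 ≤ k) :
    (gaussianReal ((s : ℝ) / 2) s (Iic ((s : ℝ) / 2 - k * s))).toReal
      ≤ Real.exp (-(k ^ 2 * (s : ℝ)) / 2) := by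
  rw [gaussianWork_dominantRegion_eq_cdf hs k]
  exact cdf_neg_mul_sqrt_le_exp hk s

variable (s)

/-- **Relative second moment of the weight power `w^k = e^{−kW_d}`**:
`⟨e^{−2kW_d}⟩ / ⟨e^{−kW_d}⟩² = e^{k²s}` — the relative variance of `w^k` under the work law is
`e^{k²s} − 1`, so a CLT error bar of relative size `ε` on `⟨w^k⟩` needs `N ≳ e^{k²s}/ε²`
evolutions (`k = 1`: `N ≫ 1/ESS`; `k = 2`: `N ≫ 1/ESS⁴`). [ours] -/
theorem gaussianWork_expMoment_relVar (k : ℝ) :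
    (∫ x, Real.exp (-(2 * k * x)) ∂(gaussianReal ((s : ℝ) / 2) s))
        / (∫ x, Real.exp (-(k * x)) ∂(gaussianReal ((s : ℝ) / 2) s)) ^ 2
      = Real.exp (k ^ 2 * (s : ℝ)) := by
  rw [gaussianWork_expMoment s (2 * k), gaussianWork_expMoment s k, ← Real.exp_nat_mul,
    ← Real.exp_sub]
  congr 1
  push_cast
  ring

/-! ## The two readings of record: the Jarzynski mean (`k = 1`) and the Kish denominator (`k = 2`) -/

variable {s}

/-- **`k = 1` (the Jarzynski mean, i.e. `ΔF̂`)**: half of `⟨e^{−W_d}⟩ = 1` is carried by the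
evolutions with NEGATIVE dissipation beyond `−s/2 = −⟨W_d⟩`:
`∫_{x ≤ −s/2} e^{−x} N(s/2, s)(dx) = 1/2`. [ours] -/
theorem gaussianWork_jarzynski_lowerHalf (hs : s ≠ 0) :
    ∫ x in Iic (-((s : ℝ) / 2)), Real.exp (-x) ∂(gaussianReal ((s : ℝ) / 2) s) = 1 / 2 := by
  have h := gaussianWork_expMoment_lowerHalf hs 1
  simp only [one_mul, sub_self, mul_zero, zero_div, Real.exp_zero] at h
  rw [show (s : ℝ) / 2 - s = -((s : ℝ) / 2) by ring] at h
  exact h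

/-- **`k = 1`**: the region carrying half of the Jarzynski mean has probability
`Φ(−√s) ≤ e^{−s/2} = √ESS_pop` under the work law. [ours] -/
theorem gaussianWork_jarzynski_dominantRegion_le (hs : s ≠ 0) :
    (gaussianReal ((s : ℝ) / 2) s (Iic (-((s : ℝ) / 2)))).toReal ≤ Real.exp (-(s : ℝ) / 2) := by
  have h := gaussianWork_dominantRegion_le hs zero_le_one
  rw [one_mul, show (s : ℝ) / 2 - s = -((s : ℝ) / 2) by ring, one_pow, one_mul] at h
  exact h

/-- **`k = 2` (the Kish denominator)**: half of `⟨e^{−2W_d}⟩ = e^{s}` is carried by the evolutions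
with `W_d ≤ −3s/2`, i.e. at least `2·Var W` below the mean work:
`∫_{x ≤ −3s/2} e^{−2x} N(s/2, s)(dx) = e^{s}/2`. [ours] -/
theorem gaussianWork_kish_lowerHalf (hs : s ≠ 0) :
    ∫ x in Iic (-(3 * (s : ℝ) / 2)), Real.exp (-(2 * x)) ∂(gaussianReal ((s : ℝ) / 2) s)
      = Real.exp (s : ℝ) / 2 := by
  have h := gaussianWork_expMoment_lowerHalf hs 2
  rw [show (s : ℝ) / 2 - 2 * s = -(3 * (s : ℝ) / 2) by ring,
    show (s : ℝ) * (2 * (2 - 1)) / 2 = (s : ℝ) by ring] at h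
  exact h

/-- **`k = 2`**: the region carrying half of the Kish denominator has probability
`Φ(−2√s) ≤ e^{−2s} = ESS_pop²` under the work law. [ours] -/
theorem gaussianWork_kish_dominantRegion_le (hs : s ≠ 0) :
    (gaussianReal ((s : ℝ) / 2) s (Iic (-(3 * (s : ℝ) / 2)))).toReal
      ≤ Real.exp (-(2 * (s : ℝ))) := by
  have h := gaussianWork_dominantRegion_le hs (by norm_num : (0 : ℝ) ≤ 2)
  rw [show (s : ℝ) / 2 - 2 * s = -(3 * (s : ℝ) / 2) by ring,
    show -((2 : ℝ) ^ 2 * (s : ℝ)) / 2 = -(2 * (s : ℝ)) by ring] at h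
  exact h

/-- **THE SAMPLE-COUNT RULE**: among `N` forward evolutions the EXPECTED NUMBER landing in the
region that carries half of `⟨e^{−2W_d}⟩` is `N·Φ(−2√s) ≤ N·e^{−2s} = N·ESS_pop²`; in particular
if `N·e^{−2s} ≤ η` that expected number is `≤ η` — below `η ≈ 1` a sample Kish ESS is not an
estimate of `e^{−s}` (the row's 'unranked (low-ESS)' label). [ours] -/
theorem gaussianWork_kish_expectedCount_le (hs : s ≠ 0) {N η : ℝ} (hN : 0 ≤ N)
    (hη : N * Real.exp (-(2 * (s : ℝ))) ≤ η) :
    N * (gaussianReal ((s : ℝ) / 2) s (Iic (-(3 * (s : ℝ) / 2)))).toReal ≤ η :=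
  (mul_le_mul_of_nonneg_left (gaussianWork_kish_dominantRegion_le hs) hN).trans hη

/-- The population ESS in the model is `e^{−s}` (`gaussianWork_kishESS`); the sample-count
threshold `e^{2s}` of `gaussianWork_kish_expectedCount_le` is its inverse SQUARE:
`e^{2s} = (e^{−s})⁻¹ ^ 2`. [ours] -/
theorem exp_two_mul_eq_inv_ess_sq (s : ℝ≥0) :
    Real.exp (2 * (s : ℝ)) = (Real.exp (-(s : ℝ)))⁻¹ ^ 2 := by
  rw [← Real.exp_neg, neg_neg, sq, ← Real.exp_add]
  congr 1
  ring

end Work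

end Summit.Ventures.LatticeQCDFlow.Theory2

namespace Summit.Ventures.LatticeQCDFlow.Theory2

open MeasureTheory ProbabilityTheory Set
open scoped NNReal ENNReal
open Summit.Ventures.LatticeQCDFlow.Exactness.GeneralNCMC (gaussianReal_withDensity_exp_linear)

/-! ## The Chatterjee–Diaconis exponents of the model: `D(N(m + vt, v) ‖ N(m, v)) = vt²/2`

(APPENDED by row 19 GEN-7 after `Scaling/JarzynskiSampleSize` / `Scaling/KishSampleSize` docked the
Literature's Chatterjee–Diaconis theorem to the NE-MCMC path space: there the sample-size exponents
are the Kullback–Leibler divergences `D(P̃_R ‖ P_F)` (Jarzynski mean) and `D(P₂ ‖ P_F)` (Kish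
denominator); here are their values in the Gaussian work model — the `k`-tilted work law against
the work law — `k²s/2`, i.e. `s/2` and `2s`, the exponents of this file's thresholds `e^{s/2}` and
`e^{2s}`.  Mathlib's `InformationTheory.klDiv`; the tilt identity of row 13 again.) -/

section TiltKL

open InformationTheory

/-- **KL divergence of an exponentially tilted Gaussian from the original**:
`D(N(m + vt, v) ‖ N(m, v)) = v·t²/2` for every real `t` and every variance `v` (the log-likelihood
ratio is the affine function `tx − (mt + vt²/2)` by the tilt identity, and `E_{N(m+vt,v)} x = m + vt`).
[ours] -/
theorem toReal_klDiv_gaussianReal_tilt (m t : ℝ) (v : ℝ≥0) :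
    (klDiv (gaussianReal (m + (v : ℝ) * t) v) (gaussianReal m v)).toReal = (v : ℝ) * t ^ 2 / 2 := by
  have htilt := gaussianReal_withDensity_exp_linear m v t
  have hmeas : Measurable fun w : ℝ =>
      ENNReal.ofReal (Real.exp (t * w - (m * t + (v : ℝ) * t ^ 2 / 2))) :=
    Measurable.ennreal_ofReal (by fun_prop)
  have hac : gaussianReal (m + (v : ℝ) * t) v ≪ gaussianReal m v := by
    rw [← htilt]; exact withDensity_absolutelyContinuous _ _
  have hrn := Measure.rnDeriv_withDensity (gaussianReal m v) hmeas
  rw [htilt] at hrn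
  have hllr : llr (gaussianReal (m + (v : ℝ) * t) v) (gaussianReal m v)
      =ᵐ[gaussianReal (m + (v : ℝ) * t) v] fun x => t * x - (m * t + (v : ℝ) * t ^ 2 / 2) := by
    filter_upwards [hac.ae_eq hrn] with x hx
    rw [llr, hx, ENNReal.toReal_ofReal (Real.exp_pos _).le, Real.log_exp]
  have hint : Integrable (fun x : ℝ => t * x) (gaussianReal (m + (v : ℝ) * t) v) := by
    have h := ((memLp_id_gaussianReal (μ := m + (v : ℝ) * t) (v := v) 1).integrable le_rfl).const_mul t
    simpa using h
  rw [toReal_klDiv_of_measure_eq hac (by simp), integral_congr_ae hllr,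
    integral_sub hint (integrable_const _), integral_const_mul, integral_id_gaussianReal,
    integral_const, smul_eq_mul, probReal_univ, one_mul]
  ring

variable (s : ℝ≥0)

/-- **The exponent of the `k`-tilted work law**: `D(N(s/2 − ks, s) ‖ N(s/2, s)) = k²s/2` — in the
Gaussian work model the Chatterjee–Diaconis sample-size exponent for the `k`-th exponential moment
is `k²s/2` (the `log` of this file's thresholds). [ours] -/
theorem gaussianWork_tiltKL (k : ℝ) :
    (klDiv (gaussianReal ((s : ℝ) / 2 - k * s) s) (gaussianReal ((s : ℝ) / 2) s)).toReal
      = k ^ 2 * (s : ℝ) / 2 := by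
  have h := toReal_klDiv_gaussianReal_tilt ((s : ℝ) / 2) (-k) s
  rw [show (s : ℝ) / 2 + (s : ℝ) * -k = (s : ℝ) / 2 - k * s by ring] at h
  rw [h]
  ring

/-- `k = 1`: `D(N(−s/2, s) ‖ N(s/2, s)) = s/2` — the model value of the REVERSE dissipation
`D(P̃_R ‖ P_F) = ΔF − ⟨W⟩_R̃` of `Scaling/JarzynskiSampleSize` (the reverse work law is the 1-tilt,
Crooks): the Jarzynski mean needs `N ≈ e^{s/2} = 1/√ESS` evolutions, both directions. [ours] -/
theorem gaussianWork_jarzynskiKL :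
    (klDiv (gaussianReal (-((s : ℝ) / 2)) s) (gaussianReal ((s : ℝ) / 2) s)).toReal
      = (s : ℝ) / 2 := by
  have h := gaussianWork_tiltKL s 1
  rw [one_mul, show (s : ℝ) / 2 - s = -((s : ℝ) / 2) by ring] at h
  rw [h]
  ring

/-- `k = 2`: `D(N(−3s/2, s) ‖ N(s/2, s)) = 2s` — the model value of `D(P₂ ‖ P_F)` of
`Scaling/KishSampleSize` (the doubly-tilted path law): the Kish denominator needs
`N ≈ e^{2s} = 1/ESS²` evolutions, both directions. [ours] -/
theorem gaussianWork_kishKL :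
    (klDiv (gaussianReal (-(3 * (s : ℝ) / 2)) s) (gaussianReal ((s : ℝ) / 2) s)).toReal
      = 2 * (s : ℝ) := by
  have h := gaussianWork_tiltKL s 2
  rw [show (s : ℝ) / 2 - 2 * s = -(3 * (s : ℝ) / 2) by ring] at h
  rw [h]
  ring

end TiltKL

end Summit.Ventures.LatticeQCDFlow.Theory2
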